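import Literature.NumberTheory.EllipticCurves.Kato2004.EulerSystemValues
import Literature.NumberTheory.EllipticCurves.Isogeny
import Literature.NumberTheory.EllipticCurves.GlobalMinimalModel
import HarnessLib

/-!
# Kato 2004 (Astérisque 295), (8.1.3) / Example 13.3 with Prop. 8.12, §8.2/Lemma 8.5, Thm. 9.7 and
# Thm. 6.6 (1) AT KATO'S OWN LATTICE `T = V_{ℤ_p}(f)(1)` — the `a(A)`-type zeta elements of the newform
# of an elliptic curve form an Euler system with rational dual-exponential values on the Tate module of
# SOME curve of the isogeny class (ONE named fact; no hypothesis on the residual image)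

Topic `NumberTheory/EllipticCurves`, sub-directory `Kato2004` (namespace = path). Companion of
`EulerSystemValues.lean` (cell `b2b-bsdres` team n1011, fact
`Kato2004.exists_eulerSystem_expStar_values`, stated on `T_pW` under `Irr(W[p])` — its design D1 (a)).
This file states the SAME matrix `Kato2004.ZetaBody` (reused verbatim, no new vocabulary) WITHOUT the
irreducibility hypothesis, at the price of an existentially displayed MEMBER `W_K` of the `ℚ`-isogeny
class of `W`: the curve whose `p`-adic Tate module is Kato's lattice.  Seat `bsd-potss-rkm` (prover,
cell `bsd-potss`, item stmt-BirchSwinnertonDyer-19196 `ReducibleKatoMember`): this is pin P1 (a) of the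
seat's realisation spec v3 — the value law is what pins Kato's zeta class at a member with REDUCIBLE
`W[p]`, where the stable lattices of `V_pW` are no longer homothetic.  HONEST FRAMING: a named fact
(`def … : Prop`, D-0014); nothing asserted, no `_holds`; it closes nothing by itself; BSD is not
advanced by it.

## The printed statements (K. Kato, Astérisque 295 (2004); store key `paper:doi-10-24033-ast-639`)

All quotations of `EulerSystemValues.lean` §"The printed statements" apply verbatim ((13.1.1) p. 225,
Ex. 13.3 p. 225, (8.1.2)–(8.1.3) p. 180, Prop. 8.12 p. 186, §8.2/Lemma 8.5 pp. 180–184, Thm. 9.7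
p. 189, Thm. 6.6 (1) p. 163).  The two sentences this file rests on in addition:
* **§8.3 [p. 181]** "`V_{O_λ}(f)` … the image of `H¹_ét(Y₁(N) ⊗ ℚ̄, ℤ_p)` … is a `Gal(ℚ̄/ℚ)`-stable
  `O_λ`-lattice of `V_{F_λ}(f)`", and **(8.1.3) [p. 180]** / **Ex. 13.3 [p. 225]** "`T = V_{O_λ}(f)(k − r)`
  … define `z_m ∈ H¹(ℤ[ζ_m, 1/p], T)` by `z_m = _{c,d}z_m^{(p)}(f, r, j, ξ, prime(mA))` … Then `(z_m)_m`
  is an Euler system for `(T, F_λ, Σ)`" — NO hypothesis on the image of `Gal(ℚ̄/ℚ) → Aut(T)` and none on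
  the reduction of `f` at `p` (the big-image condition (12.5.2) enters Kato's text only at Thm. 12.5 (4) /
  13.4 (3)).  For `f = f_W`, `k = 2`, `r = 1`, `F_λ = ℚ_p`: `T = V_{ℤ_p}(f)(1)` is a `Gal(ℚ̄/ℚ)`-stable
  `ℤ_p`-lattice of `V_{ℚ_p}(f)(1) ≅ V_pW` (Eichler–Shimura / Faltings, the reading D-W1 of
  `EulerSystemValues.lean`: `= T_pE₁`, `E₁` the `X₁(N)`-optimal curve), hence — Silverman *AEC*
  III.4.12 / Rem. III.4.13.2 + III.§7 + VIII.8.3, in the tree as the THEOREM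
  `WeierstrassCurve.exists_isIsogenous_isGloballyMinimal_tateModule_equiv_of_stableRationalLattice`
  (file `TateModuleStableRationalLatticeMemberProofs`, p419922) — `Gal(ℚ̄/ℚ)`-equivariantly isomorphic to
  `T_pW_K` for a GLOBALLY MINIMAL curve `W_K`, `ℚ`-isogenous to `W` ("Kato's member"; at an odd
  semistable `p` it is Wuthrich's `E_•`, [Wuthrich2014, Prop. 8 p. 388]; at an additive `p` no listed
  description is claimed — the member is DISPLAYED EXISTENTIALLY).  Transporting Kato's classes and his
  `exp*` along this isomorphism (unique up to `ℤ_pˣ`, absorbed by the existential `κ, Λ` exactly as in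
  design D1 (a) / finding F-κ of the companion file) gives the statement below, clause by clause the
  companion's `ZetaBody` for the curve `W_K`.

Relation to the companion fact: under `Irr(W[p])` every member's Tate module is homothetic to `T_pW`,
and `exists_eulerSystem_expStar_values` states the family on `T_pW` itself; the present fact neither
implies nor is implied by it syntactically (different carrier `tateRep W_K p`), and is the form needed on
the REDUCIBLE rows (crux `ReducibleKatoMember`, K9/K8-t′ lower halves, kmc's hull readings M1/M1♯).
NOT here: which listed curve `W_K` is; any integrality beyond (C2); Thm. 12.4–12.6, 13.14; any
divisibility or Selmer statement; `p = 2` is allowed as in print; no proof.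

## References
* K. Kato, *p-adic Hodge theory and values of zeta functions of modular forms*, Astérisque 295 (2004):
  §8.1 (8.1.2)–(8.1.3) (p. 180), §8.2 + Lemma 8.5 (pp. 180–184), §8.3 (p. 181), Prop. 8.12 (p. 186),
  Thm. 9.7 (p. 189), Thm. 6.6 (1) (p. 163), §13.1 (13.1.1) + Ex. 13.3 (pp. 224–225). [Kato2004Asterisque]
* J. H. Silverman, *The Arithmetic of Elliptic Curves*, 2nd ed., Prop. III.4.12, Rem. III.4.13.2, III.§7,
  Cor. VIII.8.3. [SilvermanAEC2009]
* C. Wuthrich, Doc. Math. 19 (2014) 381–402, §3.2 and Prop. 8 (the member at a semistable odd `p`).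
  [Wuthrich2014]
* K. Rubin, *Euler Systems*, Ann. of Math. Stud. 147 (2000), Def. 2.1.1. [Rubin2000]
* Tree: `Kato2004/EulerSystemValues.lean` (`ZetaBody`, `tateRep`, `cyclotomicLevelsRat`, `badPlaces`),
  `TateModuleStableRationalLatticeMemberProofs.lean` (the member theorem), `Isogeny.lean` (`IsIsogenous`),
  `GlobalMinimalModel.lean` (`IsGloballyMinimal`).
-/

noncomputable section

open scoped NumberField TensorProduct
open Field IsDedekindDomain CongruenceSubgroup
open Literature.NumberTheory.GaloisRepresentations
open Literature.NumberTheory.EllipticCurves Literature.NumberTheory.EllipticCurves.ModularForms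
open Literature.NumberTheory.EllipticCurves.Kato2004
open Literature.NumberTheory.EllipticCurves.Kato2004.EulerSystemValues Rat.HeightOneSpectrum

namespace Literature.NumberTheory.EllipticCurves.Kato2004

/-- **Kato 2004, (8.1.3) / Example 13.3 (`a(A)`-type, `k = 2`, `F = ℚ`, `r = j = 1`) with Prop. 8.12,
§8.2/Lemma 8.5, Thm. 9.7 and Thm. 6.6 (1), at Kato's lattice `T = V_{ℤ_p}(f)(1)` — member form, NO
image hypothesis.**  For every elliptic curve `W/ℚ` and every prime `p` there is a GLOBALLY MINIMAL
curve `W_K/ℚ`, `ℚ`-isogenous to `W` (the member with `T_pW_K ≅ V_{ℤ_p}(f)(1)` as `Gal(ℚ̄/ℚ)`-lattices: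
§8.3 p. 181 + *AEC* III.4.12 / the tree theorem
`exists_isIsogenous_isGloballyMinimal_tateModule_equiv_of_stableRationalLattice`), such that
[structure facts `ContinuousSMul / Module.Free / Module.Finite ℤ_[p] (T_pW_K)` as instance BINDERS,
discharged by the `TateModule*Proofs` theorems — convention of the companion file] for the newform `f` of
`W` (= of `W_K`: isogenous curves have the same `L`-function) and every family of complex embeddings
`ι_m : ℚ(ζ_m) → ℂ` there are ONE real constant `κ ≠ 0` and ONE dual-exponential value datum `Λ` on the
cyclotomic levels such that for all integers `c, d`, `a` and `A ≥ 1` with `(c, 6pA) = 1`, `(d, 6pN) = 1`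
(Ex. 13.3 p. 225) there exist classes `z_m ∈ H¹(ℚ(μ_m), T_pW_K)` on all levels `m = p^k·∏ℓ`, `k ≥ 0`,
`ℓ ∤ 2cdpAN`, and values `x_m ∈ ℚ(ζ_m)`, satisfying `ZetaBody W_K p f ι κ Λ c d a A z x`: Euler-system
norm relations ((13.1.1) / Prop. 8.12), unramifiedness away from `p` at class level ((8.1.3), §8.2,
Lemma 8.5), the datum axioms (readings of §9.4), rationality (Thm. 9.7) and the value law (Thm. 9.7 ∘
Thm. 6.6 (1)).  Hypotheses transcribed: NONE on the reduction of `W` at `p`, NONE on the residual image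
(print: Ex. 13.3 is stated for `T = V_{O_λ}(f)(k − r)` for every newform `f`), `p ∣ N` and `p = 2`
allowed.  The member is displayed existentially because the tree has no name for `V_{ℤ_p}(f)`; at an odd
semistable `p` it is Wuthrich's `E_•` (Prop. 8), in general no listed description is claimed.  Named
fact; nothing asserted; no `_holds` expected.
[cite: Kato2004Asterisque, (8.1.3) (p. 180), §8.2 and Lemma 8.5 (pp. 180–184), §8.3 (p. 181), Prop. 8.12 (p. 186), Thm. 9.7 (p. 189), Thm. 6.6 (1) (p. 163), §13.1 (13.1.1) and Ex. 13.3 (pp. 224–225)]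
[cite: SilvermanAEC2009, Prop. III.4.12 with Rem. III.4.13.2, III.7 and Cor. VIII.8.3]
[cite: Wuthrich2014, §3.2 (p. 394) and Prop. 8 (p. 388)] [cite: Rubin2000, Def. 2.1.1 and Remark 2.1.4] -/
def exists_member_eulerSystem_expStar_values : Prop :=
  ∀ (W : WeierstrassCurve ℚ) [W.IsElliptic] (p : ℕ) [Fact p.Prime],
    ∃ (W' : WeierstrassCurve ℚ) (_ : W'.IsElliptic) (_ : W'.IsGloballyMinimal),
    WeierstrassCurve.IsIsogenous W W' ∧
    ∀ [ContinuousSMul ℤ_[p] (W'.tateModule p)] [Module.Free ℤ_[p] (W'.tateModule p)]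
      [Module.Finite ℤ_[p] (W'.tateModule p)],
    ∀ {N : ℕ} [NeZero N] (f : CuspForm (Gamma0 N) 2), IsNewformOf W f →
    ∀ (ι : (m : ℕ) → (CyclotomicField m ℚ →+* ℂ)),
    ∃ κ : ℝ, κ ≠ 0 ∧
    ∃ Λ : ∀ (k : ℕ) (r : Finset (HeightOneSpectrum (𝓞 ℚ))),
        H1 (tateRep W' p) (cycSubgroup p k r) →ₗ[ℤ_[p]] ℚ_[p] ⊗[ℚ] CyclotomicField (cycLevel p k r) ℚ,
    ∀ (c d a : ℤ) (A : ℕ), 0 < A → Int.gcd c (6 * p * A) = 1 → Int.gcd d (6 * p * N) = 1 →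
      ∃ (z : ∀ (k : ℕ) (r : (cyclotomicLevelsRat p (badPlaces c d A N)).Ideals),
            H1 (tateRep W' p) ((cyclotomicLevelsRat p (badPlaces c d A N)).level k r.1))
        (x : ∀ (k : ℕ) (r : (cyclotomicLevelsRat p (badPlaces c d A N)).Ideals),
            CyclotomicField (cycLevel p k r.1) ℚ),
        ZetaBody W' p f ι κ Λ c d a A z x

-- TODO(general form): as in `EulerSystemValues.lean` (every `m ≥ 1`, `ξ ∈ SL₂(ℤ)`, weight `k ≥ 2`,
-- coefficients `F ≠ ℚ`, `exp*` a DEFINED map); and the member NAMED once `V_{ℤ_p}(f)` (the image of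
-- `H¹_ét(Y₁(N) ⊗ ℚ̄, ℤ_p)`) is an object of the tree.

end Literature.NumberTheory.EllipticCurves.Kato2004

end
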